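import Literature.NumberTheory.Transcendental.RoySmallValueEstimatesZeroFreeDecompProofs
import HarnessLib

/-!
# Small value estimates at rational translates (Nguyen–Roy 2016) — proofs, XVII: Roy's multiplicity estimate for the resultant (R2013 Theorem 5.2)

Seventeenth proofs file towards `Literature.NumberTheory.Transcendental.nguyenRoy2016_thm_1` (Nguyen–Roy,
IJNT 12 (2016) = arXiv:1412.5163). We PROVE **Theorem 5.2 of Roy, Mathematika 59 (2013) =
arXiv:1301.0663** ("the generic resultant for homogeneous polynomials of degree `D` in `m + 1`
variables vanishes up to order `deg(I)` at each point of `(I_D)^{m+1}`"), over an arbitrary field `K`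
of characteristic zero and in the form consumed by Proposition 6.1 there and by Nguyen–Roy's
Proposition 15 (restriction to lines): for decomposition data `𝒟` attached to forms `P₀, …, P_m` of
degree `D` with `P₀, …, P_{m−1} ∈ I` (file XVI provides them), every tuple `Q₀, …, Q_m` of forms of
degree `D` in the ideal `I` (coefficient vector `q`) and every direction `w`,

  `t^{H(I;ν)} ∣ Res_D(q + t w)` in `K[t]`   (`NguyenRoyK.DecompData.X_pow_hilbH_dvd_aeval_line_resD`),

`H(I;ν) = dim K[x]_ν − dim I_ν` the Hilbert function (`hilbH`; for `ν` large this is Roy's `deg(I)`).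
The proof is the printed one, made algebraic:

* Step 1 (`X_pow_hilbH_dvd_aeval_line_detPhi`): in coordinates of `K[x]_ν` adapted to `I_ν`
  (`exists_matrix_rows_vanish`) the `H(I;ν)` rows of `M_𝐐(q)` outside `I_ν` vanish because
  `φ_Q(A) = ∑ A_j Q_j ∈ I_ν`; the entries of `M(q + tw) = M(q) + t M(w)` are linear, so those rows are
  divisible by `t` and `t^{H} ∣ det = Φ(q + tw)` (`pow_dvd_det_of_dvd_rows`);
* Step 2 (`exists_psi`, `X_pow_hilbH_dvd_aeval_line_resD_of_psi`): `Φ = Res_D Ψ` (file XV) with `Ψ`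
  of weight `0` in the last block since both have degree `D^m` there
  (`isWeightedHomogeneous_of_mul_eq`), so `Ψ(q)` does not depend on `Q_m`
  (`aeval_eq_aeval_of_isWeightedHomogeneous_zero`); where `Ψ(q) ≠ 0`, `t ∤ Ψ(q + tw)` and
  `t^H ∣ Res_D(q + tw)`;
* Step 3 ("by continuity"): the coefficients of `t^j`, `j < H`, of `Res_D(q + tw)` are polynomials in
  the coordinates of `q ∈ I_D^{m+1}`; multiplied by `Ψ|_{I_D^{m+1}}` they vanish everywhere, and
  `Ψ|_{I_D^{m+1}} ≠ 0` (at `(P₀, …, P_{m−1}, P₀)`, as `Φ(P) ≠ 0`), so they vanish identically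
  (`MvPolynomial.funext`, `K` infinite).

Definitions are proof objects with bodies (`coefMap`, `idealPart`, `hilbH`, `coefSpace`); no named facts.

## References

* [Roy2013] D. Roy, *A small value estimate for 𝔾ₐ × 𝔾ₘ*, Mathematika 59 (2013) = arXiv:1301.0663,
  §5, Theorem 5.2 and its proof (pp. 13–14 of the arXiv text).
* [NesterenkoPhilippon2001] Yu. V. Nesterenko, P. Philippon (eds.), LNM 1752 (2001), Ch. 3 §4,
  Prop. 4.4 (block homogeneity of the associated form).
* [NguyenRoy2016] N. A. V. Nguyen, D. Roy, IJNT 12 (2016) = arXiv:1412.5163, §5, proof of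
  Proposition 15 (where Theorem 5.6 of R2013, resting on Theorem 5.2, is applied).
-/

noncomputable section

open MvPolynomial Finset

attribute [local instance] MvPolynomial.gradedAlgebra

namespace Literature.NumberTheory.Transcendental

namespace NguyenRoyK

open NguyenRoy (MonoIdx monoIdxEquivSym fintypeMonoIdx card_monoIdx veroN veroN_succ veroEquiv vexp
  degree_vexp vidx vexp_vidx vexp_injective nuD nuD_spec specForm isHomogeneous_specForm aeval_specForm
  eq_zero_of_forall_coeff)

attribute [local instance] NguyenRoy.fintypeMonoIdx

/-! ## R2013 Theorem 5.2, step 1: `t^k ∣ Φ(q + t w)` for `q ∈ I_D^{m+1}`, `k = H(I; ν)` -/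

section Thm52Phi

attribute [local instance] NguyenRoy.finiteDimensional_homogeneousSubmodule

variable {K : Type*} [Field K]

/-! ### Linear algebra: rows adapted to a subspace; rows divisible by `t` -/

/-- **Coordinates adapted to a subspace.** For a subspace `W` of `K^R` (`R` finite) there is an
invertible matrix `B` and a set `R₀` of `#R − dim W` row indices such that `B c` vanishes on `R₀`
for every `c ∈ W` (complete a basis of `W` by a basis of a complement). [folklore] -/
theorem exists_matrix_rows_vanish {R : Type*} [Fintype R] [DecidableEq R] (W : Submodule K (R → K)) :
    ∃ (B : Matrix R R K) (R₀ : Finset R), IsUnit B ∧ R₀.card + Module.finrank K W = Fintype.card R ∧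
      ∀ c ∈ W, ∀ r ∈ R₀, B.mulVec c r = 0 := by
  classical
  obtain ⟨C, hC⟩ := W.exists_isCompl
  let bW := Module.finBasis K W
  let bC := Module.finBasis K C
  let e : Module.Basis (Fin (Module.finrank K W) ⊕ Fin (Module.finrank K C)) K (R → K) :=
    (bW.prod bC).map (Submodule.prodEquivOfIsCompl W C hC)
  have hcard : Fintype.card (Fin (Module.finrank K W) ⊕ Fin (Module.finrank K C)) = Fintype.card R := by
    rw [← Module.finrank_eq_card_basis e, Module.finrank_fintype_fun_eq_card]
  let σ : R ≃ Fin (Module.finrank K W) ⊕ Fin (Module.finrank K C) :=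
    (Fintype.equivOfCardEq hcard).symm
  let B : Matrix R R K := fun r ρ => e.repr (Pi.single ρ 1) (σ r)
  have hB : ∀ c : R → K, ∀ r, B.mulVec c r = e.repr c (σ r) := by
    intro c r
    have hc : c = ∑ ρ, c ρ • (Pi.single ρ (1 : K) : R → K) := by
      ext r'
      simp [Finset.sum_apply, Pi.single_apply]
    conv_rhs => rw [hc]
    simp only [Matrix.mulVec, dotProduct, B, map_sum, map_smul, Finsupp.coe_finsetSum,
      Finset.sum_apply, Finsupp.coe_smul, Pi.smul_apply, smul_eq_mul]
    refine Finset.sum_congr rfl fun ρ _ => ?_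
    ring
  refine ⟨B, (Finset.univ : Finset (Fin (Module.finrank K C))).map
    ⟨fun i => σ.symm (Sum.inr i), fun a b h => Sum.inr_injective (σ.symm.injective h)⟩, ?_, ?_, ?_⟩
  · rw [← Matrix.mulVec_injective_iff_isUnit]
    intro c c' h
    have : e.repr c = e.repr c' := by
      ext s
      have := congrFun h (σ.symm s)
      rwa [hB, hB, Equiv.apply_symm_apply] at this
    exact e.repr.injective this
  · rw [Finset.card_map, Finset.card_univ, Fintype.card_fin, ← hcard, Fintype.card_sum,
      Fintype.card_fin, Fintype.card_fin, add_comm]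
  · intro c hc r hr
    obtain ⟨i, -, rfl⟩ := Finset.mem_map.mp hr
    rw [hB]
    simp only [Function.Embedding.coeFn_mk, Equiv.apply_symm_apply]
    have hrepr : e.repr c = (bW.prod bC).repr ((⟨c, hc⟩ : W), (0 : C)) := by
      rw [Module.Basis.map_repr, LinearEquiv.trans_apply]
      congr 1
      exact Submodule.prodEquivOfIsCompl_symm_apply_left W C hC ⟨c, hc⟩
    rw [hrepr, Module.Basis.prod_repr_inr, map_zero, Finsupp.zero_apply]

/-- A determinant whose rows indexed by `R₀` are divisible by `t` is divisible by `t^{#R₀}`.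
[folklore] -/
theorem pow_dvd_det_of_dvd_rows {R : Type*} [Fintype R] [DecidableEq R] {A : Type*} [CommRing A]
    (N : Matrix R R A) (t : A) (R₀ : Finset R) (h : ∀ r ∈ R₀, ∀ c, t ∣ N r c) :
    t ^ R₀.card ∣ N.det := by
  classical
  have h' : ∀ r c, ∃ f : A, r ∈ R₀ → N r c = t * f := by
    intro r c
    by_cases hr : r ∈ R₀
    · obtain ⟨f, hf⟩ := h r hr c
      exact ⟨f, fun _ => hf⟩
    · exact ⟨0, fun h => absurd h hr⟩
  choose f hf using h'
  let N' : Matrix R R A := fun r c => if r ∈ R₀ then f r c else N r c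
  have hN : N = Matrix.of (fun r c => (if r ∈ R₀ then t else 1) * N' r c) := by
    ext r c
    simp only [Matrix.of_apply, N']
    split_ifs with hr
    · exact hf r c hr
    · rw [one_mul]
  rw [hN, Matrix.det_mul_column, Finset.prod_ite_mem, Finset.univ_inter, Finset.prod_const]
  exact Dvd.intro _ rfl

/-! ### The coefficient vectors of `I_ν` -/

variable {m : ℕ}

/-- The coefficient map `K[x] → K^{monomials of degree ν}`. [folklore] -/
def coefMap (m ν : ℕ) : MvPolynomial (Fin (m + 1)) K →ₗ[K] (MonoIdx m ν → K) :=
  LinearMap.pi fun γ => MvPolynomial.lcoeff K γ.1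

/-- `coefMap F γ = [x^γ] F`. [folklore] -/
theorem coefMap_apply (ν : ℕ) (F : MvPolynomial (Fin (m + 1)) K) (γ : MonoIdx m ν) :
    coefMap m ν F γ = coeff γ.1 F := rfl

/-- The degree-`ν` piece `I_ν = I ∩ K[x]_ν` of an ideal, as a `K`-subspace. [folklore] -/
def idealPart (I : Ideal (MvPolynomial (Fin (m + 1)) K)) (ν : ℕ) : Submodule K (MvPolynomial (Fin (m + 1)) K) :=
  I.restrictScalars K ⊓ homogeneousSubmodule (Fin (m + 1)) K ν

/-- Membership in `I_ν`. [folklore] -/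
theorem mem_idealPart_iff {I : Ideal (MvPolynomial (Fin (m + 1)) K)} {ν : ℕ} {F : MvPolynomial (Fin (m + 1)) K} :
    F ∈ idealPart I ν ↔ F ∈ I ∧ F.IsHomogeneous ν := by
  simp only [idealPart, Submodule.mem_inf, Submodule.restrictScalars_mem, mem_homogeneousSubmodule]

/-- `I_ν` is finite-dimensional. [folklore] -/
instance finiteDimensional_idealPart (I : Ideal (MvPolynomial (Fin (m + 1)) K)) (ν : ℕ) :
    FiniteDimensional K (idealPart I ν) :=
  Submodule.finiteDimensional_of_le inf_le_right

/-- **The Hilbert function** `H(I; ν) = dim K[x]_ν − dim I_ν`. [cite: Roy2013, proof of Theorem 5.2] -/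
def hilbH (I : Ideal (MvPolynomial (Fin (m + 1)) K)) (ν : ℕ) : ℕ :=
  Module.finrank K (homogeneousSubmodule (Fin (m + 1)) K ν) - Module.finrank K (idealPart I ν)

/-- The coefficient vectors of `I_ν`. [folklore] -/
def coefSpace (I : Ideal (MvPolynomial (Fin (m + 1)) K)) (ν : ℕ) : Submodule K (MonoIdx m ν → K) :=
  LinearMap.range ((coefMap m ν).comp (idealPart I ν).subtype)

/-- The coefficient vector of an element of `I_ν` lies in `coefSpace I ν`. [folklore] -/
theorem coefMap_mem_coefSpace {I : Ideal (MvPolynomial (Fin (m + 1)) K)} {ν : ℕ}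
    {F : MvPolynomial (Fin (m + 1)) K} (hF : F ∈ idealPart I ν) : coefMap m ν F ∈ coefSpace I ν :=
  ⟨⟨F, hF⟩, rfl⟩

/-- `dim {coefficient vectors of I_ν} = dim I_ν` (a form of degree `ν` is determined by its
coefficients at the monomials of degree `ν`). [folklore] -/
theorem finrank_coefSpace (I : Ideal (MvPolynomial (Fin (m + 1)) K)) (ν : ℕ) :
    Module.finrank K (coefSpace I ν) = Module.finrank K (idealPart I ν) := by
  refine LinearMap.finrank_range_of_inj ?_
  intro F G h
  apply Subtype.ext
  rw [← sub_eq_zero]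
  have hF := (mem_idealPart_iff.mp F.2).2
  have hG := (mem_idealPart_iff.mp G.2).2
  refine NguyenRoy.eq_zero_of_forall_coeff (hF.sub hG) fun γ => ?_
  have := congrFun h γ
  simp only [LinearMap.comp_apply, Submodule.subtype_apply, coefMap_apply] at this
  rw [coeff_sub, this, sub_self]

/-! ### The line `q + t w` through the generic matrix -/

variable {D ν : ℕ} {P : ℕ → MvPolynomial (Fin (m + 1)) K}

namespace DecompData

variable {𝒟 : DecompData K m D ν P}

/-- The entries of `M(q + t w)` are `M(q) + t M(w)` (they are linear in `u`). [folklore] -/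
theorem aeval_line_genEntry (𝒟 : DecompData K m D ν P) (q w : Fin (m + 1) × Fin (veroN m D + 1) → K)
    (γ : Fin (m + 1) →₀ ℕ) (c : 𝒟.ColIdx) :
    aeval (fun v => Polynomial.C (q v) + Polynomial.C (w v) * Polynomial.X) (𝒟.genEntry γ c) =
      Polynomial.C (aeval q (𝒟.genEntry γ c)) + Polynomial.C (aeval w (𝒟.genEntry γ c)) * Polynomial.X := by
  simp only [DecompData.genEntry, map_sum, map_mul, aeval_C, aeval_X, Polynomial.algebraMap_eq,
    Algebra.algebraMap_self, RingHom.id_apply, Finset.sum_mul, ← Finset.sum_add_distrib]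
  refine Finset.sum_congr rfl fun j' _ => ?_
  ring

/-- For `Q₀, …, Q_m ∈ I` (the forms with coefficient vector `q`), every `G_v = ∑ v b Q` lies in
`I_ν`. [cite: Roy2013, proof of Theorem 5.2] -/
theorem Gvec_mem_idealPart (hP : ∀ j, (P j).IsHomogeneous D) (hDν : D ≤ ν)
    (I : Ideal (MvPolynomial (Fin (m + 1)) K)) {q : Fin (m + 1) × Fin (veroN m D + 1) → K}
    (hq : ∀ i, specForm m D q i ∈ I) (v : MonoIdx m ν → K) :
    Gvec (𝒟 := 𝒟) hP hDν q v ∈ idealPart I ν := by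
  rw [mem_idealPart_iff]
  refine ⟨?_, isHomogeneous_Gvec hP hDν q v⟩
  rw [Gvec]
  refine I.sum_mem fun ρ _ => ?_
  rw [smul_eq_C_mul]
  exact I.mul_mem_left _ (I.mul_mem_left _ (hq _))

/-- **Step 1 of Theorem 5.2: `t^{H(I;ν)} ∣ Φ(q + t w)`** whenever the forms `Q₀, …, Q_m` with
coefficient vector `q` all lie in the ideal `I` (any direction `w`). In coordinates adapted to
`I_ν` the `H(I;ν)` rows of `M(q)` outside `I_ν` vanish (the images `∑ A_j Q_j` lie in `I_ν`), so
those rows of `M(q + tw) = M(q) + t M(w)` are divisible by `t`. [cite: Roy2013, proof of Theorem 5.2] -/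
theorem X_pow_hilbH_dvd_aeval_line_detPhi (hP : ∀ j, (P j).IsHomogeneous D) (hDν : D ≤ ν)
    (I : Ideal (MvPolynomial (Fin (m + 1)) K)) {q : Fin (m + 1) × Fin (veroN m D + 1) → K}
    (hq : ∀ i, specForm m D q i ∈ I) (w : Fin (m + 1) × Fin (veroN m D + 1) → K) :
    Polynomial.X ^ hilbH I ν ∣
      aeval (fun v => Polynomial.C (q v) + Polynomial.C (w v) * Polynomial.X) (detPhi (𝒟 := 𝒟) hP hDν) := by
  classical
  obtain ⟨B, R₀, hBu, hcard, hvan⟩ := exists_matrix_rows_vanish (K := K) (coefSpace I ν (m := m))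
  -- `#R₀ = H(I; ν)`
  have hk : R₀.card = hilbH I ν := by
    rw [hilbH, ← finrank_coefSpace, NguyenRoy.finrank_homogeneousSubmodule_eq_choose,
      ← card_monoIdx m ν]
    omega
  rw [← hk, detPhi, AlgHom.map_det, AlgHom.mapMatrix_apply]
  set N := (genMat (𝒟 := 𝒟) hP hDν).map
    (aeval fun v => Polynomial.C (q v) + Polynomial.C (w v) * Polynomial.X) with hN
  set Mq := (genMat (𝒟 := 𝒟) hP hDν).map (aeval q) with hMq
  set Mw := (genMat (𝒟 := 𝒟) hP hDν).map (aeval w) with hMw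
  have hNentry : ∀ γ ρ, N γ ρ = Polynomial.C (Mq γ ρ) + Polynomial.C (Mw γ ρ) * Polynomial.X := by
    intro γ ρ
    simp only [hN, hMq, hMw, Matrix.map_apply, genMat]
    exact aeval_line_genEntry 𝒟 q w _ _
  -- rows `r ∈ R₀` of `B M(q)` vanish
  have hrow : ∀ r ∈ R₀, ∀ ρ, (B * Mq) r ρ = 0 := by
    intro r hr ρ
    have hcol : (fun γ => Mq γ ρ) = coefMap m ν (Gvec (𝒟 := 𝒟) hP hDν q (Pi.single ρ 1)) := by
      funext γ
      rw [coefMap_apply, coeff_Gvec]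
      simp only [Matrix.mulVec, dotProduct, Pi.single_apply, mul_ite, mul_one, mul_zero,
        Finset.sum_ite_eq', Finset.mem_univ, if_true]
      rfl
    have hmem := coefMap_mem_coefSpace (Gvec_mem_idealPart (𝒟 := 𝒟) hP hDν I hq (Pi.single ρ 1))
    rw [← hcol] at hmem
    have := hvan _ hmem r hr
    rw [Matrix.mul_apply]
    simpa [Matrix.mulVec, dotProduct] using this
  -- hence rows `r ∈ R₀` of `B N` are divisible by `t`
  have hdvd : ∀ r ∈ R₀, ∀ ρ, Polynomial.X ∣ (B.map Polynomial.C * N) r ρ := by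
    intro r hr ρ
    rw [Matrix.mul_apply]
    simp_rw [Matrix.map_apply, hNentry, mul_add, Finset.sum_add_distrib, ← map_mul, ← map_sum]
    have h0 : ∑ γ, B r γ * Mq γ ρ = 0 := by rw [← Matrix.mul_apply]; exact hrow r hr ρ
    rw [h0, map_zero, zero_add]
    refine Finset.dvd_sum fun γ _ => ?_
    exact Dvd.intro_left (Polynomial.C (B r γ) * Polynomial.C (Mw γ ρ)) (by ring)
  have h := pow_dvd_det_of_dvd_rows (B.map Polynomial.C * N) Polynomial.X R₀ hdvd
  rw [Matrix.det_mul] at h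
  have hu : IsUnit (B.map Polynomial.C).det := by
    rw [← RingHom.mapMatrix_apply, ← RingHom.map_det]
    exact ((Matrix.isUnit_iff_isUnit_det B).mp hBu).map _
  exact hu.dvd_mul_left.mp h

end DecompData

end Thm52Phi

/-! ## R2013 Theorem 5.2, step 2: `Φ = Res_D · Ψ` with `Ψ` free of the last block -/

section Thm52Psi

variable {K : Type*} [Field K]

/-! ### Weighted-homogeneous factors -/

/-- Components of a product with a weighted-homogeneous factor:
`(A B)_{a+n} = A · B_n` for `A` of weight `a` (weights in `ℕ`). [folklore] -/
theorem weightedHomogeneousComponent_mul_left {σ : Type*} {w : σ → ℕ} {A B : MvPolynomial σ K}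
    {a : ℕ} (hA : IsWeightedHomogeneous w A a) (n : ℕ) :
    weightedHomogeneousComponent w (a + n) (A * B) = A * weightedHomogeneousComponent w n B := by
  classical
  ext d
  rw [coeff_weightedHomogeneousComponent, coeff_mul, coeff_mul]
  have key : ∀ p : (σ →₀ ℕ) × (σ →₀ ℕ), p ∈ Finset.HasAntidiagonal.antidiagonal d → coeff p.1 A ≠ 0 →
      (Finsupp.weight w d = a + n ↔ Finsupp.weight w p.2 = n) := by
    intro p hp hx
    have hwx : Finsupp.weight w p.1 = a := hA hx
    have hsum : p.1 + p.2 = d := Finset.HasAntidiagonal.mem_antidiagonal.mp hp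
    rw [← hsum, map_add, hwx]
    omega
  split_ifs with hd
  · refine Finset.sum_congr rfl fun p hp => ?_
    rw [coeff_weightedHomogeneousComponent]
    by_cases hx : coeff p.1 A = 0
    · rw [hx, zero_mul, zero_mul]
    · rw [if_pos ((key p hp hx).mp hd)]
  · symm
    refine Finset.sum_eq_zero fun p hp => ?_
    rw [coeff_weightedHomogeneousComponent]
    by_cases hx : coeff p.1 A = 0
    · rw [hx, zero_mul]
    · rw [if_neg (fun h => hd ((key p hp hx).mpr h)), mul_zero]

/-- **The cofactor of a weighted-homogeneous polynomial in a weighted-homogeneous polynomial is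
weighted-homogeneous**: if `A ≠ 0` has weight `a`, `C = A·B` has weight `c`, then `B` has weight
`c − a`, and `a ≤ c` when `B ≠ 0` (`K[x]` is a domain: compare components). [folklore] -/
theorem isWeightedHomogeneous_of_mul_eq {σ : Type*} {w : σ → ℕ} {A B C : MvPolynomial σ K}
    {a c : ℕ} (hA : IsWeightedHomogeneous w A a) (hA0 : A ≠ 0) (hC : IsWeightedHomogeneous w C c)
    (h : A * B = C) : IsWeightedHomogeneous w B (c - a) ∧ (B ≠ 0 → a ≤ c) := by
  classical
  have main : ∀ d, coeff d B ≠ 0 → a + Finsupp.weight w d = c := by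
    intro d hd
    set n := Finsupp.weight w d with hn
    by_contra hne
    have hBn : weightedHomogeneousComponent w n B ≠ 0 := by
      intro h0
      have := congrArg (coeff d) h0
      rw [coeff_weightedHomogeneousComponent, if_pos rfl, coeff_zero] at this
      exact hd this
    have hcomp := weightedHomogeneousComponent_mul_left (B := B) hA n
    rw [h, hC.weightedHomogeneousComponent_ne (a + n) hne] at hcomp
    exact hBn ((mul_eq_zero.mp hcomp.symm).resolve_left hA0)
  refine ⟨fun d hd => ?_, fun hB0 => ?_⟩
  · have := main d hd
    omega
  · obtain ⟨d, hd⟩ := exists_coeff_ne_zero hB0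
    have := main d hd
    omega

/-- A polynomial of weight `0` for the weight of the block `u_i` does not involve the variables of
that block: its values do not depend on them. [folklore] -/
theorem aeval_eq_aeval_of_isWeightedHomogeneous_zero {r N : ℕ} {i : Fin r}
    {G : MvPolynomial (Fin r × Fin (N + 1)) K}
    (hG : IsWeightedHomogeneous (fun v : Fin r × Fin (N + 1) => if v.1 = i then (1 : ℕ) else 0) G 0)
    {L : Type*} [CommRing L] [Algebra K L] {u u' : Fin r × Fin (N + 1) → L}
    (h : ∀ v, v.1 ≠ i → u v = u' v) : aeval u G = aeval u' G := by
  classical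
  rw [MvPolynomial.aeval_def, MvPolynomial.aeval_def, MvPolynomial.eval₂_eq, MvPolynomial.eval₂_eq]
  refine Finset.sum_congr rfl fun d hd => ?_
  congr 1
  refine Finset.prod_congr rfl fun v hv => ?_
  have hw : Finsupp.weight (fun v : Fin r × Fin (N + 1) => if v.1 = i then (1 : ℕ) else 0) d = 0 :=
    hG (mem_support_iff.mp hd)
  have hv0 : v.1 ≠ i := by
    intro hvi
    rw [Finsupp.weight_apply, Finsupp.sum] at hw
    have := Finset.sum_eq_zero_iff.mp hw v hv
    rw [if_pos hvi, smul_eq_mul, mul_one] at this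
    exact (Finsupp.mem_support_iff.mp hv) this
  rw [h v hv0]

/-! ### `Ψ` -/

variable {m D ν : ℕ} {P : ℕ → MvPolynomial (Fin (m + 1)) K}

namespace DecompData

variable {𝒟 : DecompData K m D ν P}

/-- **`Φ = Res_D · Ψ` with `Ψ` of weight `0` in the last block `u_m`** (`char K = 0`, `m ≥ 1`,
`D ≥ 2`): "since the resultant is homogeneous of degree `D^m` on each factor and since `Φ` is of the
same degree on the last factor, the map `Ψ` has degree `0` on that factor". [cite: Roy2013, proof of Theorem 5.2] -/
theorem exists_psi [CharZero K] (hm : 1 ≤ m) (hD2 : 2 ≤ D) (hP : ∀ j, (P j).IsHomogeneous D) (hDν : D ≤ ν) :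
    ∃ Ψ : MvPolynomial (Fin (m + 1) × Fin (veroN m D + 1)) K,
      detPhi (𝒟 := 𝒟) hP hDν = resD K m D * Ψ ∧ Ψ ≠ 0 ∧
      IsWeightedHomogeneous (fun v : Fin (m + 1) × Fin (veroN m D + 1) => if v.1 = Fin.last m then (1 : ℕ) else 0) Ψ 0 := by
  obtain ⟨Ψ, hΨ⟩ := resD_dvd_detPhi (𝒟 := 𝒟) hm hD2 hP hDν
  have hΨ0 : Ψ ≠ 0 := by
    intro h0
    rw [h0, mul_zero] at hΨ
    exact detPhi_ne_zero (𝒟 := 𝒟) hP hDν hΨ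
  set w : Fin (m + 1) × Fin (veroN m D + 1) → ℕ := fun v => if v.1 = Fin.last m then 1 else 0 with hw
  have hres : IsWeightedHomogeneous w (resD K m D) (D ^ m) := by
    rw [← ideg_veroIdeal_eq (K := K) hm hD2]
    exact NesterenkoK.chowForm_isWeightedHomogeneous (veroIdeal K m D) (Nat.succ_pos m) (Fin.last m)
  have hphi : IsWeightedHomogeneous w (detPhi (𝒟 := 𝒟) hP hDν) (D ^ m) := by
    rw [← 𝒟.dimE_last]
    exact isWeightedHomogeneous_detPhi hP hDν (Fin.last m)
  have h := (isWeightedHomogeneous_of_mul_eq hres (resD_ne_zero (K := K) hm hD2) hphi hΨ.symm).1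
  rw [Nat.sub_self] at h
  exact ⟨Ψ, hΨ, hΨ0, h⟩

/-- **Step 2 of Theorem 5.2: `t^{H(I;ν)} ∣ Res_D(q + t w)` at the points `q ∈ I^{m+1}` where
`Ψ(q) ≠ 0`** (there `Ψ(q + tw)` is a unit modulo `t`). [cite: Roy2013, proof of Theorem 5.2] -/
theorem X_pow_hilbH_dvd_aeval_line_resD_of_psi
    (hP : ∀ j, (P j).IsHomogeneous D) (hDν : D ≤ ν)
    {Ψ : MvPolynomial (Fin (m + 1) × Fin (veroN m D + 1)) K} (hΨ : detPhi (𝒟 := 𝒟) hP hDν = resD K m D * Ψ)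
    (I : Ideal (MvPolynomial (Fin (m + 1)) K)) {q : Fin (m + 1) × Fin (veroN m D + 1) → K}
    (hq : ∀ i, specForm m D q i ∈ I) (hΨq : aeval q Ψ ≠ 0) (w : Fin (m + 1) × Fin (veroN m D + 1) → K) :
    Polynomial.X ^ hilbH I ν ∣
      aeval (fun v => Polynomial.C (q v) + Polynomial.C (w v) * Polynomial.X) (resD K m D) := by
  have h := X_pow_hilbH_dvd_aeval_line_detPhi (𝒟 := 𝒟) hP hDν I hq w
  rw [hΨ, map_mul, mul_comm] at h
  -- `t ∤ Ψ(q + tw)` as `Ψ(q) ≠ 0`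
  have hndvd : ¬ Polynomial.X ∣ aeval (fun v => Polynomial.C (q v) + Polynomial.C (w v) * Polynomial.X) Ψ := by
    intro hX
    apply hΨq
    rw [Polynomial.X_dvd_iff, Polynomial.coeff_zero_eq_eval_zero, eval_aeval_eq] at hX
    simpa only [Polynomial.eval_add, Polynomial.eval_C, Polynomial.eval_mul, Polynomial.eval_X,
      mul_zero, add_zero] using hX
  exact Polynomial.prime_X.pow_dvd_of_dvd_mul_left (hilbH I ν) hndvd h

end DecompData

end Thm52Psi

/-! ## R2013 Theorem 5.2, step 3: removing `Ψ(q) ≠ 0` ("by continuity") -/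

section Thm52Final

variable {K : Type*} [Field K] {m D ν : ℕ} {P : ℕ → MvPolynomial (Fin (m + 1)) K}

namespace DecompData

/-- The coefficients of a specialised form are the specialised coefficients. [folklore] -/
theorem coeff_vexp_specForm {L : Type*} [CommRing L] (q : Fin (m + 1) × Fin (veroN m D + 1) → L)
    (i : Fin (m + 1)) (j : Fin (veroN m D + 1)) : coeff (vexp m D j) (specForm m D q i) = q (i, j) := by
  classical
  rw [specForm, coeff_sum, Finset.sum_eq_single j]
  · rw [coeff_monomial, if_pos rfl]
  · intro j' _ hj'
    rw [coeff_monomial, if_neg (fun h => hj' (vexp_injective m D h))]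
  · intro h
    exact absurd (Finset.mem_univ j) h

/-- A form of degree `D` is the specialised form of its coefficient vector (one form). [folklore] -/
theorem specForm_coeff_single {L : Type*} [Field L] {F : MvPolynomial (Fin (m + 1)) L}
    (hF : F.IsHomogeneous D) (i : Fin (m + 1)) :
    specForm m D (fun v : Fin (m + 1) × Fin (veroN m D + 1) => coeff (vexp m D v.2) F) i = F :=
  NguyenRoyK.DecompData.specForm_coeff (K := L) (R := fun _ => F) (fun _ => hF) i

/-- A polynomial divisible by `X^k` has vanishing coefficients below `k`. [folklore] -/
theorem coeff_eq_zero_of_X_pow_dvd {A : Type*} [CommSemiring A] {p : Polynomial A} {k j : ℕ}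
    (h : Polynomial.X ^ k ∣ p) (hj : j < k) : p.coeff j = 0 := by
  obtain ⟨r, rfl⟩ := h
  rw [Polynomial.coeff_X_pow_mul', if_neg (not_le.mpr hj)]

variable {𝒟 : DecompData K m D ν P}

/-- **R2013 Theorem 5.2 (for given decomposition data)**: let `char K = 0`, `m ≥ 1`, `D ≥ 2`,
`𝒟` decomposition data for forms `P₀, …, P_m` of degree `D` in degree `ν ≥ D`
(`K[x]_ν = ⊕ E_j P_j`, `dim E_m = D^m`), `I` an ideal containing `P₀, …, P_{m−1}`. Then for every
`(m+1)`-tuple `Q₀, …, Q_m` of forms of degree `D` lying in `I` (coefficient vector `q`) and every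
direction `w`, **`t^{H(I;ν)}` divides `Res_D(q + t w)`**: the resultant vanishes to order at least
`H(I;ν) = dim K[x]_ν − dim I_ν` at each point of `I_D^{m+1}`. Proof: steps 1–2 give this where
`Ψ(q) ≠ 0`; the coefficients of `t^j` (`j < H`) in `Res_D(q + tw)`, as polynomials in the coordinates
of `q ∈ I_D^{m+1}`, are killed by multiplication with `Ψ|_{I_D^{m+1}} ≠ 0` (non-zero at
`(P₀, …, P_{m−1}, P₀)` because `Ψ` does not depend on the last block and `Φ(P) ≠ 0`), hence vanish
identically (`K` is infinite). [cite: Roy2013, Theorem 5.2 and its proof] -/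
theorem X_pow_hilbH_dvd_aeval_line_resD [CharZero K] (𝒟 : DecompData K m D ν P) (hm : 1 ≤ m)
    (hD2 : 2 ≤ D) (hP : ∀ j, (P j).IsHomogeneous D) (hDν : D ≤ ν)
    (I : Ideal (MvPolynomial (Fin (m + 1)) K))
    (hPI : ∀ j < m, P j ∈ I) {q : Fin (m + 1) × Fin (veroN m D + 1) → K}
    (hq : ∀ i, specForm m D q i ∈ I) (w : Fin (m + 1) × Fin (veroN m D + 1) → K) :
    Polynomial.X ^ hilbH I ν ∣
      aeval (fun v => Polynomial.C (q v) + Polynomial.C (w v) * Polynomial.X) (resD K m D) := by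
  classical
  haveI : Infinite K := Infinite.of_injective _ Nat.cast_injective
  obtain ⟨Ψ, hΨ, -, hΨw⟩ := exists_psi (𝒟 := 𝒟) hm hD2 hP hDν
  -- a basis of `I_D`, the coordinates `a ↦ pt a` of `I_D^{m+1}` and the generic point `qU`
  set s := Module.finrank K (idealPart I D) with hs
  let bI := Module.finBasis K (idealPart I D)
  let g : Fin s → MvPolynomial (Fin (m + 1)) K := fun l => (bI l : MvPolynomial (Fin (m + 1)) K)
  have hg : ∀ l, g l ∈ idealPart I D := fun l => (bI l).2
  let A := MvPolynomial (Fin (m + 1) × Fin s) K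
  let qU : Fin (m + 1) × Fin (veroN m D + 1) → A :=
    fun v => ∑ l, X (v.1, l) * C (coeff (vexp m D v.2) (g l))
  let pt : (Fin (m + 1) × Fin s → K) → Fin (m + 1) × Fin (veroN m D + 1) → K :=
    fun a v => ∑ l, a (v.1, l) * coeff (vexp m D v.2) (g l)
  have hpt_eval : ∀ a v, aeval a (qU v) = pt a v := by
    intro a v
    simp only [qU, pt, map_sum, map_mul, aeval_X, aeval_C, Algebra.algebraMap_self, RingHom.id_apply]
  -- coordinates of elements of `I_D`
  have hcoord : ∀ (a : Fin (m + 1) × Fin s → K) (i : Fin (m + 1)) (F : idealPart I D),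
      (∀ l, a (i, l) = bI.repr F l) → ∀ j, pt a (i, j) = coeff (vexp m D j) (F : MvPolynomial (Fin (m + 1)) K) := by
    intro a i F ha j
    have hsum := bI.sum_repr F
    have hsum' := congrArg
      (fun G : idealPart I D => coeff (vexp m D j) (G : MvPolynomial (Fin (m + 1)) K)) hsum
    simp only [Submodule.coe_sum, Submodule.coe_smul, coeff_sum, coeff_smul, smul_eq_mul] at hsum'
    rw [← hsum']
    simp only [pt]
    exact Finset.sum_congr rfl fun l _ => by rw [ha l]
  have hpt_spec : ∀ a i, specForm m D (pt a) i = ∑ l, a (i, l) • g l := by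
    intro a i
    have hF : (∑ l, a (i, l) • g l).IsHomogeneous D :=
      MvPolynomial.IsHomogeneous.sum _ _ _ fun l _ =>
        (homogeneousSubmodule (Fin (m + 1)) K D).smul_mem _ (mem_idealPart_iff.mp (hg l)).2
    conv_rhs => rw [← specForm_coeff_single hF i]
    simp only [specForm]
    refine Finset.sum_congr rfl fun j _ => ?_
    congr 1
    simp only [pt, coeff_sum, coeff_smul, smul_eq_mul]
  have hpt_mem : ∀ a i, specForm m D (pt a) i ∈ I := by
    intro a i
    rw [hpt_spec]
    exact I.sum_mem fun l _ => by
      rw [smul_eq_C_mul]; exact I.mul_mem_left _ (mem_idealPart_iff.mp (hg l)).1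
  -- every `q'` with all `Q_i ∈ I` is a point `pt a`
  have hsurj : ∀ q' : Fin (m + 1) × Fin (veroN m D + 1) → K, (∀ i, specForm m D q' i ∈ I) →
      ∃ a, pt a = q' := by
    intro q' hq'
    have hmem : ∀ i, specForm m D q' i ∈ idealPart I D := fun i =>
      mem_idealPart_iff.mpr ⟨hq' i, isHomogeneous_specForm m D q' i⟩
    refine ⟨fun p => bI.repr ⟨specForm m D q' p.1, hmem p.1⟩ p.2, ?_⟩
    funext v
    obtain ⟨i, j⟩ := v
    rw [hcoord (fun p => bI.repr ⟨specForm m D q' p.1, hmem p.1⟩ p.2) i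
      ⟨specForm m D q' i, hmem i⟩ (fun l => rfl) j]
    exact coeff_vexp_specForm q' i j
  -- the universal restricted line `Res_D(qU + t w)` and `Ψ(qU)`
  let Rq : Polynomial A :=
    aeval (fun v => Polynomial.C (qU v) + Polynomial.C (C (w v)) * Polynomial.X) (resD K m D)
  let Ψq : A := aeval qU Ψ
  have hRq : ∀ a, Rq.map (MvPolynomial.eval a) =
      aeval (fun v => Polynomial.C (pt a v) + Polynomial.C (w v) * Polynomial.X) (resD K m D) := by
    intro a
    have key : ((Polynomial.mapAlgHom (aeval a : A →ₐ[K] K)).comp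
        (aeval (R := K) fun v => Polynomial.C (qU v) + Polynomial.C (C (w v)) * Polynomial.X)) =
        aeval (R := K) fun v => Polynomial.C (pt a v) + Polynomial.C (w v) * Polynomial.X := by
      refine MvPolynomial.algHom_ext fun v => ?_
      rw [AlgHom.comp_apply, aeval_X, aeval_X, Polynomial.coe_mapAlgHom, Polynomial.map_add,
        Polynomial.map_mul, Polynomial.map_C, Polynomial.map_C, Polynomial.map_X]
      simp only [RingHom.coe_coe, hpt_eval, aeval_C, Algebra.algebraMap_self, RingHom.id_apply]
    have := congrArg (fun φ => φ (resD K m D)) key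
    simpa [Polynomial.coe_mapAlgHom] using this
  have hΨq : ∀ a, MvPolynomial.eval a Ψq = aeval (pt a) Ψ := by
    intro a
    have hfun : (fun i => aeval a (qU i)) = pt a := funext (hpt_eval a)
    rw [← MvPolynomial.coe_aeval_eq_eval]
    change ((aeval a).comp (aeval qU)) Ψ = _
    rw [MvPolynomial.comp_aeval, hfun]
  -- `Ψq ≠ 0`: evaluate at the coordinates of `(P₀, …, P_{m−1}, P₀)`
  have hPmem : ∀ i : Fin (m + 1), P (if i = Fin.last m then 0 else (i : ℕ)) ∈ idealPart I D := by
    intro i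
    refine mem_idealPart_iff.mpr ⟨?_, hP _⟩
    split_ifs with hi
    · exact hPI 0 (by omega)
    · exact hPI i (Fin.val_lt_last hi)
  let a₀ : Fin (m + 1) × Fin s → K := fun p => bI.repr ⟨_, hPmem p.1⟩ p.2
  have hΨq0 : Ψq ≠ 0 := by
    intro h0
    have h1 : MvPolynomial.eval a₀ Ψq = 0 := by rw [h0, map_zero]
    rw [hΨq] at h1
    -- `Ψ(pt a₀) = Ψ(coefficients of P)` as they agree off the last block
    have h2 : aeval (pt a₀) Ψ =
        aeval (fun v : Fin (m + 1) × Fin (veroN m D + 1) => coeff (vexp m D v.2) (P v.1)) Ψ := by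
      refine aeval_eq_aeval_of_isWeightedHomogeneous_zero hΨw fun v hv => ?_
      rw [hcoord a₀ v.1 ⟨_, hPmem v.1⟩ (fun l => rfl) v.2]
      simp only [if_neg hv]
    rw [h2] at h1
    have h3 := aeval_coeff_detPhi_ne_zero (𝒟 := 𝒟) hP hDν
    rw [hΨ, map_mul, h1, mul_zero] at h3
    exact h3 rfl
  -- the coefficients of `t^j`, `j < H`, of `Res_D(qU + tw)` vanish identically
  have hcoef : ∀ j < hilbH I ν, Rq.coeff j = 0 := by
    intro j hj
    have hprod : Rq.coeff j * Ψq = 0 := by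
      apply MvPolynomial.funext
      intro a
      rw [map_zero, map_mul]
      by_cases hzero : aeval (pt a) Ψ = 0
      · rw [hΨq, hzero, mul_zero]
      · have hdiv := X_pow_hilbH_dvd_aeval_line_resD_of_psi (𝒟 := 𝒟) hP hDν hΨ I (hpt_mem a) hzero w
        rw [← hRq a] at hdiv
        have := coeff_eq_zero_of_X_pow_dvd hdiv hj
        rw [Polynomial.coeff_map] at this
        rw [this, zero_mul]
    exact (mul_eq_zero.mp hprod).resolve_right hΨq0
  have hdvd : Polynomial.X ^ hilbH I ν ∣ Rq := Polynomial.X_pow_dvd_iff.mpr hcoef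
  -- specialise to `q = pt a`
  obtain ⟨a, rfl⟩ := hsurj q hq
  have h := map_dvd (Polynomial.mapRingHom (MvPolynomial.eval a)) hdvd
  rw [Polynomial.coe_mapRingHom, Polynomial.map_pow, Polynomial.map_X, hRq a] at h
  exact h

end DecompData

end Thm52Final

end NguyenRoyK

end Literature.NumberTheory.Transcendental
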